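import Mathlib.Analysis.SpecialFunctions.Trigonometric.InverseDeriv
import Mathlib.Analysis.SpecialFunctions.Sqrt
import Literature.Barriers.AtomisticToContinuum.TetrahedralFrustration
import HarnessLib

/-!
# The strong dodecahedral theorem, I: Hales's `Δ`, `υ`, `dih(y₁,…,y₆)`, `soly`, and the constant `y_D`

First of three companion files (`StrongDodecahedralDih`, `StrongDodecahedralConstants`,
`StrongDodecahedralReduction`) to the named fact
`Literature.Barriers.AtomisticToContinuum.HalesDSP_strongDodecahedral`
(`TetrahedralFrustrationProofs.lean`) — Theorem 8.44 of Hales's *Dense Sphere Packings*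
(`HalesDSP2012`, §8.6), K. Bezdek's strong dodecahedral conjecture: the surface area of a Voronoi
cell of a packing of unit balls is at least that of the regular dodecahedron of inradius `1`.
The printed proof (Lemma 8.56) is: a computer-verified local inequality on Marchal `D_k`-cells
(Lemma 8.55) with constants `a_D, b_D, y_D` (Definition 8.51), summed over the cells of the
truncated Voronoi cell, plus the estimate `∑ L(h) ≤ 12` (Lemma\* 6.95, the Flyspeck `L12`).  It is
computer-assisted twice over and rests on the cell geometry of Chapter 6; these files formalise
the part that is elementary — the functions and constants of Definition 8.51 with the identities
(8.53), (8.54) and the closing arithmetic of Lemma 8.56 — and reduce Theorem 8.44 to two named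
facts plus `L12` (`StrongDodecahedralReduction`).

## This file (everything PROVED)

* `halesDelta` — the polynomial `Δ(x₁,…,x₆)` (Definition 2.43, Cayley–Menger), `halesDelta4` — its
  partial derivative `Δ₄ = ∂Δ/∂x₄` (`hasDerivAt_halesDelta`), `halesUps` — `υ(x,y,z)`
  (Definition 2.56) with Heron's factorisation (`halesUps_sq`) and the identity
  `υυ − Δ₄² = 4x₁Δ` (`halesUps_mul_halesUps_sub_sq`, Lemma 2.72).
* `dihX x₁ … x₆ = arccos (Δ₄ / √(υ(x₁,x₂,x₆) υ(x₁,x₃,x₅)))` — the dihedral angle of a tetrahedron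
  along its first edge as a function of the squared edge lengths (the first formula of Lemma 2.72;
  Flyspeck's `dih_x`), `dihY` — the same in the edge lengths (`dih` of (7.41); Flyspeck's `dih_y`),
  `dihY₂`, `dihY₃` — (7.41), `solY = dih + dih₂ + dih₃ − π` — Girard (§8.6.2).
* **Lemma 2.72 PROVED** (`arccos_dihCos_eq_dihX`): `dihX` of the squared edge lengths is the
  vector dihedral angle `arccos (dihCos v₀ v₁ v₂ v₃)` of Definition 2.66 (vendored in
  `TetrahedralFrustration.lean`), via `w̄₂·w̄₃ = x₁Δ₄/4`, `w̄₂·w̄₂ = x₁υ/4` — this checks the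
  transcription of `Δ₄`, `υ` against the geometry.
* The symmetric family `(2,2,2,y,y,y)` (three edges `2` at the apex over an equilateral triangle
  of side `y`): `dih = arccos ((8 − y²)/(16 − y²))` for `0 < y < 4` (`dihY_symm`),
  `soly = 3 dih − π` (`solY_symm`), injectivity in `y` (`dihY_symm_inj`).
* `dodecYD = √(8 − 8√5/5) ≈ 2.1029` — Hales's `y_D` in CLOSED FORM (the edge of the regular
  icosahedron of circumradius `2`), with its DEFINING PROPERTY (8.54) proved:
  `soly(2,2,2,y_D,y_D,y_D) = π/5`, `dih(2,2,2,y_D,y_D,y_D) = 2π/5` (`solY_dodecYD`, `dihY_dodecYD`,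
  `two_mul_solY_dodecYD`), uniqueness on `0 < y < 4` (`solY_symm_eq_pi_div_five_iff`), and the
  bracket `y_D ∈ (2.1029, 2.103)`.

## Design choices

* `dihX` takes the `arccos` formula of Lemma 2.72 as the definition (Flyspeck defines `dih_x` by
  the equivalent `π/2 − arctan₂(√(4x₁Δ), Δ₄)`; the two agree on nondegenerate tetrahedra,
  `Δ > 0`).  Junk values: if `υ(x₁,x₂,x₆) υ(x₁,x₃,x₅) ≤ 0` (a collinear face) the quotient is `0`
  and `dihX = π/2`; arguments outside `[−1, 1]` are clamped by `Real.arccos`.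
* `y_D` is given in closed form and its defining equation is a theorem, rather than defined by
  `Classical.choose`; likewise `a_D`, `b_D` in `StrongDodecahedralConstants`.

## Sources

* T. C. Hales, *Dense Sphere Packings: A Blueprint for Formal Proofs*, LMS Lecture Note Series
  400, CUP 2012 (`HalesDSP2012`): Definition 2.43 (`Δ`), Definition 2.56 and Lemma 2.57 (`υ`),
  Definition 2.66 (`dih_V`), Lemma 2.72 (edge-length formula), Lemma 3.23 (Girard),
  Definition 7.39 (7.41) (`dih_i`), §8.6.2 (`soly`), Definition 8.51 and (8.54) (`y_D`).
-/

noncomputable section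

open Real

namespace Literature.Barriers.AtomisticToContinuum

/-! ### The polynomials `Δ` and `υ` -/

/-- **Hales's polynomial `Δ(x₁,…,x₆)`** (the Cayley–Menger determinant of a tetrahedron in the
squared edge lengths `(x₁,…,x₆) = (x₀₁, x₀₂, x₀₃, x₂₃, x₁₃, x₁₂)`; `4D² = Δ`, so the
tetrahedron has volume `√Δ/12`). [cite: HalesDSP2012, Definition 2.43] -/
def halesDelta (x₁ x₂ x₃ x₄ x₅ x₆ : ℝ) : ℝ :=
  x₁ * x₄ * (-x₁ + x₂ + x₃ - x₄ + x₅ + x₆) + x₂ * x₅ * (x₁ - x₂ + x₃ + x₄ - x₅ + x₆)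
    + x₃ * x₆ * (x₁ + x₂ - x₃ + x₄ + x₅ - x₆)
    - x₂ * x₃ * x₄ - x₁ * x₃ * x₅ - x₁ * x₂ * x₆ - x₄ * x₅ * x₆

/-- **`Δ₄`, the partial derivative of `Δ` with respect to `x₄`** (see
`hasDerivAt_halesDelta`). [cite: HalesDSP2012, Lemma 2.72] -/
def halesDelta4 (x₁ x₂ x₃ x₄ x₅ x₆ : ℝ) : ℝ :=
  x₁ * (-x₁ + x₂ + x₃ - 2 * x₄ + x₅ + x₆) + x₂ * x₅ + x₃ * x₆ - x₂ * x₃ - x₅ * x₆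

/-- `Δ₄ = ∂Δ/∂x₄`. [cite: HalesDSP2012, Lemma 2.72] -/
theorem hasDerivAt_halesDelta (x₁ x₂ x₃ x₄ x₅ x₆ : ℝ) :
    HasDerivAt (fun t => halesDelta x₁ x₂ x₃ t x₅ x₆) (halesDelta4 x₁ x₂ x₃ x₄ x₅ x₆) x₄ := by
  set β : ℝ := x₁ * (-x₁ + x₂ + x₃ + x₅ + x₆) + x₂ * x₅ + x₃ * x₆ - x₂ * x₃ - x₅ * x₆ with hβ
  set γ : ℝ := x₂ * x₅ * (x₁ - x₂ + x₃ - x₅ + x₆) + x₃ * x₆ * (x₁ + x₂ - x₃ + x₅ - x₆)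
    - x₁ * x₃ * x₅ - x₁ * x₂ * x₆ with hγ
  have hf : ∀ t, halesDelta x₁ x₂ x₃ t x₅ x₆ = -x₁ * t ^ 2 + β * t + γ := by
    intro t
    simp only [halesDelta, hβ, hγ]
    ring
  have h : HasDerivAt (fun t => -x₁ * t ^ 2 + β * t + γ) (-x₁ * (2 * x₄) + β) x₄ := by
    have h1 : HasDerivAt (fun t : ℝ => t ^ 2) (2 * x₄) x₄ := by
      simpa using hasDerivAt_pow 2 x₄
    exact ((h1.const_mul (-x₁)).add ((hasDerivAt_id x₄).const_mul β |>.congr_deriv (by simp))).add_const γ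
  refine (h.congr_of_eventuallyEq (Filter.Eventually.of_forall hf)).congr_deriv ?_
  simp only [halesDelta4, hβ]
  ring

/-- **Hales's polynomial `υ(x, y, z) = −x² − y² − z² + 2xy + 2yz + 2zx`** (for a triangle with
squared sides `x, y, z` this is `16 · area²`, Heron). [cite: HalesDSP2012, Definition 2.56] -/
def halesUps (x y z : ℝ) : ℝ := -x ^ 2 - y ^ 2 - z ^ 2 + 2 * x * y + 2 * y * z + 2 * z * x

/-- Heron's factorisation `υ(a², b², c²) = (a+b+c)(−a+b+c)(a−b+c)(a+b−c) = 16 s(s−a)(s−b)(s−c)`.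
[cite: HalesDSP2012, Lemma 2.57 (2.58)] -/
theorem halesUps_sq (a b c : ℝ) :
    halesUps (a ^ 2) (b ^ 2) (c ^ 2) = (a + b + c) * (-a + b + c) * (a - b + c) * (a + b - c) := by
  unfold halesUps
  ring

/-- The polynomial identity `υ(x₁,x₂,x₆) υ(x₁,x₃,x₅) − Δ₄² = 4 x₁ Δ` behind the `arctan₂` form of
the dihedral angle. [cite: HalesDSP2012, Lemma 2.72 (proof)] -/
theorem halesUps_mul_halesUps_sub_sq (x₁ x₂ x₃ x₄ x₅ x₆ : ℝ) :
    halesUps x₁ x₂ x₆ * halesUps x₁ x₃ x₅ - halesDelta4 x₁ x₂ x₃ x₄ x₅ x₆ ^ 2 =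
      4 * x₁ * halesDelta x₁ x₂ x₃ x₄ x₅ x₆ := by
  unfold halesUps halesDelta4 halesDelta
  ring

/-! ### The dihedral angle as a function of edge lengths -/

/-- **`dih_x(x₁,…,x₆) = arccos (Δ₄ / √(υ(x₁,x₂,x₆) υ(x₁,x₃,x₅)))`**: the dihedral angle of the
tetrahedron `{v₀,v₁,v₂,v₃}` along the edge `{v₀,v₁}` as a function of the squared edge lengths
`(x₀₁, x₀₂, x₀₃, x₂₃, x₁₃, x₁₂)` (Lemma 2.72: this equals `dih_V({v₀,v₁},{v₂,v₃})` whenever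
`{v₀,v₁,v₂}` and `{v₀,v₁,v₃}` are not collinear; see `arccos_dihCos_eq_dihX`).  Junk value `π/2`
when `υ(x₁,x₂,x₆) υ(x₁,x₃,x₅) ≤ 0` (division by `√0 = 0`). [cite: HalesDSP2012, Lemma 2.72] -/
def dihX (x₁ x₂ x₃ x₄ x₅ x₆ : ℝ) : ℝ :=
  arccos (halesDelta4 x₁ x₂ x₃ x₄ x₅ x₆ / √(halesUps x₁ x₂ x₆ * halesUps x₁ x₃ x₅))

/-- **`dih(y₁,…,y₆) = dih_x(y₁²,…,y₆²)`**, the dihedral angle along the first edge as a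
function of the edge LENGTHS `(y₀₁, y₀₂, y₀₃, y₂₃, y₁₃, y₁₂)` — the function `dih = dih₁` of
(7.41). [cite: HalesDSP2012, Lemma 2.72 and (7.41)] -/
def dihY (y₁ y₂ y₃ y₄ y₅ y₆ : ℝ) : ℝ :=
  dihX (y₁ ^ 2) (y₂ ^ 2) (y₃ ^ 2) (y₄ ^ 2) (y₅ ^ 2) (y₆ ^ 2)

/-- `dih₂(y₁,…,y₆) = dih(y₂, y₃, y₁, y₅, y₆, y₄)`, the dihedral angle along the edge
`{v₀, v₂}`. [cite: HalesDSP2012, Definition 7.39 (7.41)] -/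
def dihY₂ (y₁ y₂ y₃ y₄ y₅ y₆ : ℝ) : ℝ := dihY y₂ y₃ y₁ y₅ y₆ y₄

/-- `dih₃(y₁,…,y₆) = dih(y₃, y₁, y₂, y₆, y₄, y₅)`, the dihedral angle along the edge
`{v₀, v₃}`. [cite: HalesDSP2012, Definition 7.39 (7.41)] -/
def dihY₃ (y₁ y₂ y₃ y₄ y₅ y₆ : ℝ) : ℝ := dihY y₃ y₁ y₂ y₆ y₄ y₅

/-- **`soly(y) = dih₁(y) + dih₂(y) + dih₃(y) − π`**, the solid angle at `v₀` of the simplex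
`{v₀,v₁,v₂,v₃}` with edge lengths `y` (Girard's formula, Lemma 3.23).
[cite: HalesDSP2012, §8.6.2 (p. 254)] -/
def solY (y₁ y₂ y₃ y₄ y₅ y₆ : ℝ) : ℝ :=
  dihY y₁ y₂ y₃ y₄ y₅ y₆ + dihY₂ y₁ y₂ y₃ y₄ y₅ y₆ + dihY₃ y₁ y₂ y₃ y₄ y₅ y₆ - π

/-! ### Lemma 2.72: agreement with the vector definition `dih_V` (Definition 2.66) -/

/-- `w̄₂ · w̄₃ = x₁ Δ₄ / 4` in the notation of Definition 2.66 (`w̄ᵢ = (w₁·w₁) wᵢ − (w₁·wᵢ) w₁`,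
`x₁ = w₁·w₁`, `x₂ = w₂·w₂`, `x₃ = w₃·w₃`, `x₄ = |w₂ − w₃|²`, `x₅ = |w₁ − w₃|²`, `x₆ = |w₁ − w₂|²`).
[cite: HalesDSP2012, Lemma 2.72 (proof)] -/
theorem dihProj_dotProduct_dihProj (w₁ w₂ w₃ : Fin 3 → ℝ) :
    dihProj w₁ w₂ ⬝ᵥ dihProj w₁ w₃ =
      (w₁ ⬝ᵥ w₁) * halesDelta4 (w₁ ⬝ᵥ w₁) (w₂ ⬝ᵥ w₂) (w₃ ⬝ᵥ w₃) ((w₂ - w₃) ⬝ᵥ (w₂ - w₃))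
        ((w₁ - w₃) ⬝ᵥ (w₁ - w₃)) ((w₁ - w₂) ⬝ᵥ (w₁ - w₂)) / 4 := by
  simp only [dihProj, halesDelta4, dotProduct, Fin.sum_univ_three, Pi.sub_apply, Pi.smul_apply,
    smul_eq_mul]
  ring

/-- `w̄₂ · w̄₂ = x₁ υ(x₁, x₂, x₆) / 4`. [cite: HalesDSP2012, Lemma 2.72 (proof)] -/
theorem dihProj_dotProduct_self (w₁ w₂ : Fin 3 → ℝ) :
    dihProj w₁ w₂ ⬝ᵥ dihProj w₁ w₂ =
      (w₁ ⬝ᵥ w₁) * halesUps (w₁ ⬝ᵥ w₁) (w₂ ⬝ᵥ w₂) ((w₁ - w₂) ⬝ᵥ (w₁ - w₂)) / 4 := by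
  simp only [dihProj, halesUps, dotProduct, Fin.sum_univ_three, Pi.sub_apply, Pi.smul_apply,
    smul_eq_mul]
  ring

/-- **Lemma 2.72**: the dihedral angle `dih_V({v₀,v₁},{v₂,v₃}) = arccos (dihCos v₀ v₁ v₂ v₃)` of
Definition 2.66 equals `dih_x` of the squared edge lengths, provided `v₀ ≠ v₁` (for collinear
`{v₀,v₁,v₂}` or `{v₀,v₁,v₃}` both sides are the junk value `arccos 0 = π/2`).
[cite: HalesDSP2012, Lemma 2.72] -/
theorem arccos_dihCos_eq_dihX (v₀ v₁ v₂ v₃ : Fin 3 → ℝ) (h01 : 0 < (v₁ - v₀) ⬝ᵥ (v₁ - v₀)) :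
    arccos (dihCos v₀ v₁ v₂ v₃) =
      dihX ((v₁ - v₀) ⬝ᵥ (v₁ - v₀)) ((v₂ - v₀) ⬝ᵥ (v₂ - v₀)) ((v₃ - v₀) ⬝ᵥ (v₃ - v₀))
        ((v₂ - v₃) ⬝ᵥ (v₂ - v₃)) ((v₁ - v₃) ⬝ᵥ (v₁ - v₃)) ((v₁ - v₂) ⬝ᵥ (v₁ - v₂)) := by
  unfold dihCos dihX
  congr 1
  set w₁ := v₁ - v₀
  set w₂ := v₂ - v₀
  set w₃ := v₃ - v₀
  have e23 : v₂ - v₃ = w₂ - w₃ := by simp [w₂, w₃]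
  have e13 : v₁ - v₃ = w₁ - w₃ := by simp [w₁, w₃]
  have e12 : v₁ - v₂ = w₁ - w₂ := by simp [w₁, w₂]
  rw [e23, e13, e12, dihProj_dotProduct_dihProj, dihProj_dotProduct_self, dihProj_dotProduct_self]
  set x₁ := w₁ ⬝ᵥ w₁
  set U₂ := halesUps x₁ (w₂ ⬝ᵥ w₂) ((w₁ - w₂) ⬝ᵥ (w₁ - w₂))
  set U₃ := halesUps x₁ (w₃ ⬝ᵥ w₃) ((w₁ - w₃) ⬝ᵥ (w₁ - w₃))
  have hnn : ∀ w : Fin 3 → ℝ, 0 ≤ dihProj w₁ w ⬝ᵥ dihProj w₁ w := fun w => by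
    unfold dotProduct
    exact Finset.sum_nonneg fun i _ => mul_self_nonneg _
  have hU : ∀ w : Fin 3 → ℝ, 0 ≤ halesUps x₁ (w ⬝ᵥ w) ((w₁ - w) ⬝ᵥ (w₁ - w)) := fun w => by
    have h := hnn w
    rw [dihProj_dotProduct_self] at h
    by_contra hneg
    push Not at hneg
    have := mul_neg_of_pos_of_neg h01 hneg
    linarith
  have hU₂ : 0 ≤ U₂ := hU w₂
  have hU₃ : 0 ≤ U₃ := hU w₃
  rw [← sqrt_mul (by positivity)]
  rw [show x₁ * U₂ / 4 * (x₁ * U₃ / 4) = (x₁ / 4) ^ 2 * (U₂ * U₃) by ring,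
    sqrt_mul (by positivity), sqrt_sq (by positivity)]
  rcases eq_or_ne (√(U₂ * U₃)) 0 with h0 | h0
  · simp [h0]
  · field_simp

/-! ### The symmetric family `(2, 2, 2, y, y, y)` -/

/-- `Δ₄(4,4,4,s,s,s) = s (8 − s)`. [folklore] -/
theorem halesDelta4_symm (s : ℝ) : halesDelta4 4 4 4 s s s = s * (8 - s) := by
  unfold halesDelta4; ring

/-- `υ(4,4,s) = s (16 − s)`. [folklore] -/
theorem halesUps_four_four (s : ℝ) : halesUps 4 4 s = s * (16 - s) := by
  unfold halesUps; ring

/-- `Δ(4,4,4,s,s,s) = s² (12 − s)`: the simplex with three edges `2` at the apex over an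
equilateral triangle of side `y = √s` is nondegenerate iff `0 < y < 2√3`. [folklore] -/
theorem halesDelta_symm (s : ℝ) : halesDelta 4 4 4 s s s = s ^ 2 * (12 - s) := by
  unfold halesDelta; ring

/-- **On the symmetric family, `dih(2,2,2,y,y,y) = arccos ((8 − y²)/(16 − y²))`** for
`0 < y < 4`. [folklore] -/
theorem dihY_symm {y : ℝ} (hy : 0 < y) (hy4 : y < 4) :
    dihY 2 2 2 y y y = arccos ((8 - y ^ 2) / (16 - y ^ 2)) := by
  unfold dihY dihX
  rw [show (2:ℝ) ^ 2 = 4 by norm_num, halesDelta4_symm, halesUps_four_four]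
  congr 1
  have hs : 0 < y ^ 2 := by positivity
  have h16 : 0 < 16 - y ^ 2 := by nlinarith
  rw [sqrt_mul_self (by positivity), mul_div_mul_left _ _ hs.ne']

/-- `dih₂ = dih₃ = dih` on the symmetric family, hence **`soly(2,2,2,y,y,y) = 3 dih(2,2,2,y,y,y) − π`**
(Girard). [folklore] -/
theorem solY_symm (y : ℝ) : solY 2 2 2 y y y = 3 * dihY 2 2 2 y y y - π := by
  unfold solY dihY₂ dihY₃; ring

/-- The ratio `(8 − y²)/(16 − y²)` is `< 1` for `|y| < 4`. [folklore] -/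
theorem symmRatio_lt_one {y : ℝ} (hy4 : y ^ 2 < 16) :
    (8 - y ^ 2) / (16 - y ^ 2) < 1 := by
  rw [div_lt_one (by linarith)]
  linarith

/-- The ratio `(8 − y²)/(16 − y²)` is `> −1` iff `y² < 12` (for `y² < 16`). [folklore] -/
theorem neg_one_lt_symmRatio {y : ℝ} (hy12 : y ^ 2 < 12) :
    -1 < (8 - y ^ 2) / (16 - y ^ 2) := by
  rw [lt_div_iff₀ (by linarith)]
  linarith

/-- **`dih(2,2,2,y,y,y)` is injective in `y ∈ (0, 4)` away from the flat range**: if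
`0 < y, y' < 4`, `y² < 12` and the two dihedral angles agree then `y = y'`. [folklore] -/
theorem dihY_symm_inj {y y' : ℝ} (hy : 0 < y) (hy12 : y ^ 2 < 12) (hy' : 0 < y') (hy4' : y' < 4)
    (h : dihY 2 2 2 y y y = dihY 2 2 2 y' y' y') : y = y' := by
  have hy4 : y < 4 := by nlinarith
  rw [dihY_symm hy hy4, dihY_symm hy' hy4'] at h
  have hr1 := symmRatio_lt_one (y := y) (by nlinarith)
  have hr2 := neg_one_lt_symmRatio hy12
  rcases lt_or_ge (y' ^ 2) 12 with h12' | h12'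
  · have hr1' := symmRatio_lt_one (y := y') (by nlinarith)
    have hr2' := neg_one_lt_symmRatio h12'
    have hinj := arccos_inj hr2.le hr1.le hr2'.le hr1'.le |>.1 h
    have h16 : (16 : ℝ) - y ^ 2 ≠ 0 := by nlinarith
    have h16' : (16 : ℝ) - y' ^ 2 ≠ 0 := by nlinarith
    rw [div_eq_div_iff h16 h16'] at hinj
    have hsq : y ^ 2 = y' ^ 2 := by nlinarith
    exact (pow_left_inj₀ hy.le hy'.le (by norm_num)).1 hsq
  · exfalso
    have hle : (8 - y' ^ 2) / (16 - y' ^ 2) ≤ -1 := by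
      rw [div_le_iff₀ (by nlinarith)]
      linarith
    rw [arccos_of_le_neg_one hle] at h
    have hlt : arccos ((8 - y ^ 2) / (16 - y ^ 2)) < π := by
      rw [← arccos_neg_one]
      exact strictAntiOn_arccos (by simp) ⟨hr2.le, hr1.le⟩ hr2
    linarith

/-! ### The constant `y_D` and the identities (8.54) -/

/-- **`y_D = √(8 − 8√5/5) ≈ 2.1029`**, in closed form: the edge length of the regular icosahedron
of circumradius `2` (so that twenty simplices `(2,2,2,y_D,y_D,y_D)` around a common apex close up,
their Voronoi parts at the apex forming the regular dodecahedron of inradius `1`).  Hales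
DEFINES `y_D` by the condition `soly(2,2,2,y_D,y_D,y_D) = π/5`; that this closed form satisfies
it, and is the only `y ∈ (0, 4)` that does, is `solY_dodecYD` / `solY_symm_eq_pi_div_five_iff`.
[cite: HalesDSP2012, Definition 8.51] -/
def dodecYD : ℝ := √(8 - 8 * √5 / 5)

/-- `y_D² = 8 − 8√5/5`. [folklore] -/
theorem dodecYD_sq : dodecYD ^ 2 = 8 - 8 * √5 / 5 :=
  sq_sqrt (by nlinarith [sqrt_five_bounds.2])

/-- `0 < y_D`. [folklore] -/
theorem dodecYD_pos : 0 < dodecYD :=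
  sqrt_pos.2 (by nlinarith [sqrt_five_bounds.2])

/-- `y_D ∈ (2.1029, 2.103)` (Hales: `y_D ≈ 2.1029`). [cite: HalesDSP2012, Definition 8.51] -/
theorem dodecYD_bounds : (2.1029 : ℝ) < dodecYD ∧ dodecYD < 2.103 := by
  have hsq := dodecYD_sq
  have hpos := dodecYD_pos
  obtain ⟨h1, h2⟩ := sqrt_five_bounds
  constructor <;> nlinarith

/-- `y_D² < 12` (the simplex `(2,2,2,y_D,y_D,y_D)` is nondegenerate) and `y_D < 4`. [folklore] -/
theorem dodecYD_sq_lt : dodecYD ^ 2 < 12 ∧ dodecYD < 4 := by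
  have := dodecYD_bounds
  constructor <;> nlinarith

/-- At `y = y_D` the ratio `(8 − y²)/(16 − y²)` is `(√5 − 1)/4 = cos (2π/5)`. [folklore] -/
theorem symmRatio_dodecYD : (8 - dodecYD ^ 2) / (16 - dodecYD ^ 2) = cos (2 * π / 5) := by
  rw [dodecYD_sq, cos_two_pi_div_five]
  have h5 : √5 ^ 2 = 5 := sq_sqrt (by norm_num)
  have hne : (16 : ℝ) - (8 - 8 * √5 / 5) ≠ 0 := by nlinarith [sqrt_five_bounds.1]
  rw [div_eq_iff hne]
  linear_combination (-2 / 5 : ℝ) * h5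

/-- **(8.54), dihedral part: `dih(2,2,2,y_D,y_D,y_D) = 2π/5`** (five such simplices fit around
each apex edge). [cite: HalesDSP2012, Definition 8.51 (8.54)] -/
theorem dihY_dodecYD : dihY 2 2 2 dodecYD dodecYD dodecYD = 2 * π / 5 := by
  rw [dihY_symm dodecYD_pos dodecYD_sq_lt.2, symmRatio_dodecYD,
    arccos_cos (by positivity) (by linarith [pi_pos])]

/-- **(8.54), solid-angle part — the defining property of `y_D`:
`soly(2,2,2,y_D,y_D,y_D) = π/5`** (twenty such simplices fill the solid angle `4π` at the apex).
[cite: HalesDSP2012, Definition 8.51 (8.54)] -/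
theorem solY_dodecYD : solY 2 2 2 dodecYD dodecYD dodecYD = π / 5 := by
  rw [solY_symm, dihY_dodecYD]; ring

/-- (8.54) as printed: `2 soly(2,2,2,y_D,y_D,y_D) = dih(2,2,2,y_D,y_D,y_D) = 2π/5`.
[cite: HalesDSP2012, Definition 8.51 (8.54)] -/
theorem two_mul_solY_dodecYD :
    2 * solY 2 2 2 dodecYD dodecYD dodecYD = dihY 2 2 2 dodecYD dodecYD dodecYD ∧
      dihY 2 2 2 dodecYD dodecYD dodecYD = 2 * π / 5 := by
  rw [solY_dodecYD, dihY_dodecYD]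
  constructor <;> ring

/-- **`y_D` is determined by its defining condition**: for `0 < y < 4` (every nondegenerate or
flat simplex `(2,2,2,y,y,y)`), `soly(2,2,2,y,y,y) = π/5 ↔ y = y_D`.
[cite: HalesDSP2012, Definition 8.51] -/
theorem solY_symm_eq_pi_div_five_iff {y : ℝ} (hy : 0 < y) (hy4 : y < 4) :
    solY 2 2 2 y y y = π / 5 ↔ y = dodecYD := by
  refine ⟨fun h => ?_, fun h => h ▸ solY_dodecYD⟩
  rw [solY_symm] at h
  have hd : dihY 2 2 2 y y y = dihY 2 2 2 dodecYD dodecYD dodecYD := by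
    rw [dihY_dodecYD]; linarith
  exact (dihY_symm_inj dodecYD_pos dodecYD_sq_lt.1 hy hy4 hd.symm).symm

end Literature.Barriers.AtomisticToContinuum

end
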